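import Literature.Geometry.Lorentzian.KerrRedShiftFrameInversion
import HarnessLib

/-!
# The red-shift multiplier is coercive on a collar of width LINEAR in the surface gravity, with
# coercivity constant LINEAR in the surface gravity (κ-explicit DRSR Prop. 4.5.1, first bullet)
(namespace `Literature.Geometry.Lorentzian.Kerr`.)

`KerrRedShiftCoercivity.lean` proves DRSR Prop. 4.5.1 (first bullet) for the explicit red-shift multiplier
`N = (1 + h₁(r − r₊))K + (1 + f₁(r − r₊))k` by the printed compactness argument ("by continuity",
`Kerr.exists_redShift_bulk_coercive`), which hides how the collar width and the coercivity constant depend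
on `a`, i.e. on the surface gravity `κ = Kerr.surfaceGravity M a` — the one honest `κ`-dependence of the
physical-space estimates near extremality (at `κ = 0` there is no red-shift). Here it is made explicit,
uniformly on the whole sub-extremal range `|a| < M`:

* `Kerr.redShift_offHorizon_algebra` — the real-algebra core (four Young inequalities);
* `Kerr.redShift_bulk_coercive_poly` — **with the parameters `h₁ = f₁ = 512/(M²κ)`, at every point `x`
  with `r₊ ≤ r(x) ≤ r₊ + M²κ/4096` and for every `w : E4 → ℝ`,
  `(κ/4000) ∑_μ (∂_μw(x))² ≤ K^N[w](x)`**: collar width `M²κ/4096` (LINEAR in `κ`), coercivity constant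
  `κ/4000` (LINEAR in `κ`), multiplier of size `≍ κ⁻¹`.

Mechanism (`KerrRedShiftBulkOffHorizon.lean`): in the horizon frame `(λ, v, q̸)` the exact bulk off the
horizon has `v²`-coefficient `((r₊ − M) + s + ½f₁s²)/Σ ≥ (r₊ − M)/Σ` (`s = r − r₊`; no loss off the
horizon: the `−½f₁Δ/Σ` of the square completion is exactly compensated by the growth of
`(1 + f₁s)(r − M)/Σ`), the horizon cross terms with perturbed bounded coefficients (absorbed by Young's
inequality under `(r₊ − M)h₁ ≥ 968`, `(r₊ − M)f₁ ≥ 128`, as on the horizon), and two NEW cross terms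
against the axial component `p(Φ)` with coefficients `h₁α`, `(2r/Σ)α`, `|α| ≤ 2s/Σ`, which are small
against the `v²`-coefficient `≍ κ` exactly when `s ≲ κ`, BECAUSE `h₁ ≍ κ⁻¹` — whence the linear width
(a naive Lipschitz bound of `K^N` in `r` has constant `≍ κ⁻¹` and would only give a width `≍ κ²`). The
Euclidean density is recovered by `Kerr.sum_sq_le_of_horizonFrame` (`KerrRedShiftFrameInversion.lean`).

## References
* M. Dafermos, I. Rodnianski, Y. Shlapentokh-Rothman, arXiv:1402.7034, Prop. 4.5.1, Prop. 4.5.2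
  (key `DafermosRodnianskiShlapentokhrothman2014`).
* M. Dafermos, I. Rodnianski, arXiv:0811.0354, §3.3.2, Thm. 7.1 (key `DafermosRodnianski2008`).
-/

noncomputable section

open Set Filter
open scoped Topology

namespace Literature.Geometry.Lorentzian.Kerr

variable {M a : ℝ} {x : E4}

/-! ### Real-algebra core -/

/-- Young's inequality `c·pq ≤ εq² + (c²/4ε)p²` (`ε > 0`, any real `c`). [folklore] -/
theorem redShift_young (c p q ε : ℝ) (hε : 0 < ε) : c * (p * q) ≤ ε * q ^ 2 + c ^ 2 / (4 * ε) * p ^ 2 := by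
  rw [← sub_nonneg]
  have e : ε * q ^ 2 + c ^ 2 / (4 * ε) * p ^ 2 - c * (p * q) = (2 * ε * q - c * p) ^ 2 / (4 * ε) := by
    field_simp
    ring
  rw [e]
  positivity
/-- Young's inequality with absolute value: `|c·pq| ≤ εq² + (c²/4ε)p²`. [folklore] -/
theorem redShift_abs_young (c p q ε : ℝ) (hε : 0 < ε) : |c * (p * q)| ≤ ε * q ^ 2 + c ^ 2 / (4 * ε) * p ^ 2 := by
  rw [abs_le]
  refine ⟨?_, redShift_young c p q ε hε⟩
  have h := redShift_young (-c) p q ε hε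
  rw [neg_sq] at h
  linarith
/-- **The red-shift off the horizon, real-algebra core** (the off-horizon analogue of
`Kerr.redShift_horizon_algebra`). For the form
`TS·hλ² + ½fQ + c_vv v² − c_λv λv + c_A vA − hαλE + c_E vE` with `TS ≥ 1`, `c_vv ≥ δ/S`, `0 ≤ c_λv ≤ 11R/S`,
`|c_A| ≤ 4R/S`, `|c_E| ≤ 4R|α|/S`, `A² ≤ QW ≤ Q`, `E² ≤ TX`, `X ≤ 190(λ² + v² + Q)`, thresholds `δh ≥ 968`,
`δf ≥ 128` (`0 < δ ≤ R`, `R² ≤ S`) and the smallness `380hα²T ≤ δ/(8S)`, `6080α²T/δ ≤ δ/(8S)` of the axial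
coefficient: the form dominates `(δ/(8S))(λ² + v² + Q)` (four Young inequalities). [folklore] -/
theorem redShift_offHorizon_algebra {S δ R h f α TS cvv clv cA cE lam v Q A E X W T : ℝ}
    (hS : 0 < S) (hδ : 0 < δ) (hR : 0 < R) (hδR : δ ≤ R) (hRS : R ^ 2 ≤ S) (hTS : 1 ≤ TS)
    (hh : 968 ≤ δ * h) (hf : 128 ≤ δ * f) (hcvv : δ / S ≤ cvv) (hclv0 : 0 ≤ clv)
    (hclv : clv ≤ 11 * R / S) (hcA : |cA| ≤ 4 * R / S) (hcE : |cE| ≤ 4 * R * |α| / S)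
    (hQ : 0 ≤ Q) (hW1 : W ≤ 1) (hCS : A ^ 2 ≤ Q * W) (hT : 0 ≤ T)
    (hE : E ^ 2 ≤ T * X) (hX : X ≤ 190 * (lam ^ 2 + v ^ 2 + Q))
    (hα1 : 380 * h * α ^ 2 * T ≤ δ / (8 * S)) (hα2 : 6080 * α ^ 2 * T / δ ≤ δ / (8 * S)) :
    δ / (8 * S) * (lam ^ 2 + v ^ 2 + Q) ≤
      TS * h * lam ^ 2 + 2⁻¹ * f * Q + cvv * v ^ 2 - clv * lam * v + cA * v * A - h * α * lam * E +
        cE * v * E := by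
  -- positivity of the parameters
  have hh0 : 0 < h := by
    by_contra hcon; push Not at hcon
    nlinarith only [hh, hδ, hcon]
  have hf0 : 0 < f := by
    by_contra hcon; push Not at hcon
    nlinarith only [hf, hδ, hcon]
  set D : ℝ := δ / S with hD
  have hD0 : 0 < D := div_pos hδ hS
  have hRδ : 0 < R := hR
  -- `D ≤ 1/δ ≤ h/968`, `D ≤ f/128`
  have hD1 : D ≤ 1 / δ := by
    rw [hD, div_le_div_iff₀ hS hδ, one_mul]
    nlinarith only [hδR, hRS, hδ]
  have hDh : D ≤ h / 2 := by
    have : 1 / δ ≤ h / 2 := by rw [div_le_div_iff₀ hδ two_pos]; linarith only [hh]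
    exact hD1.trans this
  have hDf : D ≤ f := by
    have : 1 / δ ≤ f := by rw [div_le_iff₀ hδ]; linarith only [hf]
    exact hD1.trans this
  set Y : ℝ := lam ^ 2 + v ^ 2 + Q with hY
  have hY0 : 0 ≤ Y := by positivity
  -- ### t1: the `λv` cross term
  have t1 : |clv * (lam * v)| ≤ D / 4 * v ^ 2 + h / 8 * lam ^ 2 := by
    refine (redShift_abs_young clv lam v (D / 4) (by positivity)).trans (add_le_add le_rfl ?_)
    refine mul_le_mul_of_nonneg_right ?_ (sq_nonneg lam)
    -- `clv² / D ≤ 121 R²/(S δ) ≤ 121/δ ≤ h/8`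
    have h1 : clv ^ 2 ≤ (11 * R / S) ^ 2 := pow_le_pow_left₀ hclv0 hclv 2
    have h2 : (11 * R / S) ^ 2 / (4 * (D / 4)) = 121 * R ^ 2 / (S * δ) := by
      rw [hD]; field_simp; ring
    calc clv ^ 2 / (4 * (D / 4)) ≤ (11 * R / S) ^ 2 / (4 * (D / 4)) :=
          div_le_div_of_nonneg_right h1 (by positivity)
      _ = 121 * R ^ 2 / (S * δ) := h2
      _ ≤ 121 / δ := by
          rw [div_le_div_iff₀ (by positivity) hδ]
          nlinarith only [hRS, hδ]
      _ ≤ h / 8 := by rw [div_le_div_iff₀ hδ (by norm_num)]; linarith only [hh]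
  -- ### t2: the `vA` cross term
  have t2 : |cA * (A * v)| ≤ D / 4 * v ^ 2 + f / 8 * Q := by
    refine (redShift_abs_young cA A v (D / 4) (by positivity)).trans (add_le_add le_rfl ?_)
    have hA2 : A ^ 2 ≤ Q := hCS.trans (mul_le_of_le_one_right hQ hW1)
    have h1 : cA ^ 2 ≤ (4 * R / S) ^ 2 := by
      rw [← sq_abs cA]; exact pow_le_pow_left₀ (abs_nonneg _) hcA 2
    have h2 : (4 * R / S) ^ 2 / (4 * (D / 4)) = 16 * R ^ 2 / (S * δ) := by
      rw [hD]; field_simp; ring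
    have h3 : cA ^ 2 / (4 * (D / 4)) ≤ f / 8 := by
      calc cA ^ 2 / (4 * (D / 4)) ≤ (4 * R / S) ^ 2 / (4 * (D / 4)) :=
            div_le_div_of_nonneg_right h1 (by positivity)
        _ = 16 * R ^ 2 / (S * δ) := h2
        _ ≤ 16 / δ := by
            rw [div_le_div_iff₀ (by positivity) hδ]
            nlinarith only [hRS, hδ]
        _ ≤ f / 8 := by rw [div_le_div_iff₀ hδ (by norm_num)]; linarith only [hf]
    exact mul_le_mul h3 hA2 (sq_nonneg A) (by positivity)
  -- ### t3: the `λE` cross term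
  have hEY : E ^ 2 ≤ 190 * T * Y := by
    calc E ^ 2 ≤ T * X := hE
      _ ≤ T * (190 * Y) := mul_le_mul_of_nonneg_left hX hT
      _ = 190 * T * Y := by ring
  have t3 : |h * α * (E * lam)| ≤ h / 8 * lam ^ 2 + D / 8 * Y := by
    refine (redShift_abs_young (h * α) E lam (h / 8) (by positivity)).trans (add_le_add le_rfl ?_)
    have h2 : (h * α) ^ 2 / (4 * (h / 8)) = 2 * h * α ^ 2 := by
      field_simp; ring
    rw [h2]
    calc 2 * h * α ^ 2 * E ^ 2 ≤ 2 * h * α ^ 2 * (190 * T * Y) :=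
          mul_le_mul_of_nonneg_left hEY (by positivity)
      _ = 380 * h * α ^ 2 * T * Y := by ring
      _ ≤ D / 8 * Y := by
          refine mul_le_mul_of_nonneg_right (hα1.trans_eq ?_) hY0
          rw [hD]; ring
  -- ### t4: the `vE` cross term
  have t4 : |cE * (E * v)| ≤ D / 8 * v ^ 2 + D / 8 * Y := by
    refine (redShift_abs_young cE E v (D / 8) (by positivity)).trans (add_le_add le_rfl ?_)
    have h1 : cE ^ 2 ≤ (4 * R * |α| / S) ^ 2 := by
      rw [← sq_abs cE]; exact pow_le_pow_left₀ (abs_nonneg _) hcE 2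
    have h2 : (4 * R * |α| / S) ^ 2 / (4 * (D / 8)) = 32 * R ^ 2 * α ^ 2 / (S * δ) := by
      rw [hD, div_pow, mul_pow, mul_pow, sq_abs]; field_simp; ring
    have h3 : cE ^ 2 / (4 * (D / 8)) ≤ 32 * α ^ 2 / δ := by
      calc cE ^ 2 / (4 * (D / 8)) ≤ (4 * R * |α| / S) ^ 2 / (4 * (D / 8)) :=
            div_le_div_of_nonneg_right h1 (by positivity)
        _ = 32 * R ^ 2 * α ^ 2 / (S * δ) := h2
        _ ≤ 32 * α ^ 2 / δ := by
            rw [div_le_div_iff₀ (by positivity) hδ]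
            have : 0 ≤ α ^ 2 * δ := mul_nonneg (sq_nonneg α) hδ.le
            nlinarith only [hRS, this]
    calc cE ^ 2 / (4 * (D / 8)) * E ^ 2 ≤ 32 * α ^ 2 / δ * (190 * T * Y) :=
          mul_le_mul h3 hEY (sq_nonneg E) (by positivity)
      _ = 6080 * α ^ 2 * T / δ * Y := by ring
      _ ≤ D / 8 * Y := by
          refine mul_le_mul_of_nonneg_right (hα2.trans_eq ?_) hY0
          rw [hD]; ring
  -- ### the main terms
  have m1 : h * lam ^ 2 ≤ TS * h * lam ^ 2 := by
    have : 0 ≤ h * lam ^ 2 := by positivity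
    nlinarith only [hTS, this]
  have m2 : D * v ^ 2 ≤ cvv * v ^ 2 := mul_le_mul_of_nonneg_right hcvv (sq_nonneg v)
  have m3 : D * lam ^ 2 ≤ h / 2 * lam ^ 2 := mul_le_mul_of_nonneg_right hDh (sq_nonneg lam)
  have m4 : D * Q ≤ f * Q := mul_le_mul_of_nonneg_right hDf hQ
  -- ### conclusion
  have e1 := neg_abs_le (clv * (lam * v))
  have e2 := neg_abs_le (cA * (A * v))
  have e3 := neg_abs_le (h * α * (E * lam))
  have e4 := neg_abs_le (cE * (E * v))
  have e1' := le_abs_self (clv * (lam * v))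
  have e3' := le_abs_self (h * α * (E * lam))
  rw [show δ / (8 * S) = D / 8 by rw [hD]; ring]
  nlinarith only [t1, t2, t3, t4, m1, m2, m3, m4, e1, e2, e3, e4, e1', e3', hY, hY0, hD0,
    sq_nonneg lam, sq_nonneg v, hQ, hh0, hf0]

/-! ### The κ-explicit red-shift on the linear collar -/

/-- **The red-shift multiplier is coercive on a collar of width linear in `κ`, with constant linear in
`κ`** (DRSR Prop. 4.5.1, first bullet, `κ`-explicit; Dafermos–Rodnianski Thm. 7.1 with the rates made
explicit on Kerr). Let `|a| < M`, `κ = Kerr.surfaceGravity M a`, and let `N` be the red-shift multiplier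
`Kerr.redShiftVector M a h₁ f₁` with `h₁ = f₁ = 512/(M²κ)`. Then at every point `x` of the collar
`r₊ ≤ r(x) ≤ r₊ + M²κ/4096` and for every `w : E4 → ℝ`,
`(κ/4000) ∑_μ (∂_μ w(x))² ≤ K^N[w](x)`.
Proof: `Kerr.multiplierBulk_redShiftVector_offHorizon` + `Kerr.redShift_offHorizon_algebra` with
`δ = r₊ − M = 2Mr₊κ` (`δh₁ = 1024r₊/M`), `|α| ≤ 2s/Σ`, `h₁s ≤ 1/8`, `Σ ≤ r² + a² ≤ 2Σ`, then
`Kerr.sum_sq_le_of_horizonFrame` and `δ/(8Σ) ≥ κ/21`. [cite: DafermosRodnianskiShlapentokhrothman2014, Prop. 4.5.1] -/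
theorem redShift_bulk_coercive_poly (hMa : IsSubextremal M a) (hr₁ : rPlus M a ≤ radius a x)
    (hr₂ : radius a x ≤ rPlus M a + M ^ 2 * surfaceGravity M a / 4096) (w : E4 → ℝ) :
    surfaceGravity M a / 4000 * ∑ μ, fderiv ℝ w x (E4.basisVector μ) ^ 2 ≤
      KerrSchild.multiplierBulk (inverseMetric M a)
        (redShiftVector M a (512 / (M ^ 2 * surfaceGravity M a)) (512 / (M ^ 2 * surfaceGravity M a)))
          w x := by
  have hM : 0 < M := hMa.pos
  have hMa' : |a| ≤ M := le_of_lt hMa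
  obtain ⟨hκ, hκle, hrp, hrp2, hs0, hs1, hδ, hδlo, hra⟩ := collar_parameters hMa hr₁ hr₂
  have hrp0 : 0 < rPlus M a := by linarith only [hM, hrp]
  obtain ⟨s, hs⟩ : ∃ s : ℝ, radius a x - rPlus M a = s := ⟨_, rfl⟩
  rw [hs] at hs0 hs1
  have hr : radius a x = rPlus M a + s := by linarith only [hs]
  have hx : 0 < radius a x := by linarith only [hr, hrp0, hs0]
  have hS := blSigma_spatial_pos hx
  -- the frame inversion (before `S` is renamed)
  have hX := sum_sq_le_of_horizonFrame hMa hr₁ hr₂ (fun μ ↦ fderiv ℝ w x (E4.basisVector μ))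
  set S := blSigma a (E4.spatial x) with hS_def
  set κ := surfaceGravity M a with hκ_def
  set δ := rPlus M a - M with hδ_def
  set p : Fin 4 → ℝ := fun μ ↦ fderiv ℝ w x (E4.basisVector μ) with hp_def
  have hRS : radius a x ^ 2 ≤ S := sq_le_blSigma_spatial hx
  have hSM : M ^ 2 ≤ S := by nlinarith only [hRS, hrp, hr, hs0, hM]
  have ha2 : a ^ 2 ≤ M ^ 2 := by nlinarith only [sq_abs a, abs_nonneg a, hMa']
  have hMκ : M * κ ≤ 1 / 4 := by
    rw [le_div_iff₀ (by positivity : (0 : ℝ) < 4 * M)] at hκle; linarith only [hκle]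
  have hsκ : s ≤ M ^ 2 * κ / 4096 := hs1
  have hsM : s ≤ M / 16384 := by
    have : M ^ 2 * κ / 4096 ≤ M / 16384 := by
      rw [div_le_div_iff₀ (by norm_num) (by norm_num)]; nlinarith only [hMκ, hM]
    linarith only [hs1, this]
  have hδ0 : 0 < δ := lt_of_lt_of_le (by positivity) hδlo
  have hδr : δ ≤ radius a x := by rw [hδ_def]; linarith only [hr, hs0, hM]
  have hsr : s ≤ radius a x := by linarith only [hr, hrp0]
  -- `W`, `T = r² + a²`, `H`
  have hW0 : 0 ≤ frameAngSq a x (dRadius a x) := frameAngSq_nonneg hx _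
  have hWeq : frameAngSq a x (dRadius a x) = (radius a x ^ 2 + a ^ 2 - S) / S := frameAngSq_dRadius hx
  have hTS : S ≤ radius a x ^ 2 + a ^ 2 := by
    have h := hW0; rw [hWeq, le_div_iff₀ hS] at h; linarith only [h]
  have hT2 : radius a x ^ 2 + a ^ 2 ≤ 2 * S := by linarith only [hRS, ha2, hSM]
  have hT5 : radius a x ^ 2 + a ^ 2 ≤ 5 * M ^ 2 + M ^ 2 / 100 := by
    rw [hr]; nlinarith only [hrp2, hsM, hs0, hM, ha2, hrp]
  have hW1 : frameAngSq a x (dRadius a x) ≤ 1 := by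
    rw [hWeq, div_le_one hS]; linarith only [hT2]
  -- `Δ = s(s + 2δ)`
  have hΔeq : radius a x ^ 2 - 2 * M * radius a x + a ^ 2 = s * (s + 2 * δ) := by
    rw [hr, hδ_def]; linear_combination hra
  have hΔ0 : 0 ≤ radius a x ^ 2 - 2 * M * radius a x + a ^ 2 := by
    rw [hΔeq]; exact mul_nonneg hs0 (by linarith only [hs0, hδ0])
  have hΔ3 : radius a x ^ 2 - 2 * M * radius a x + a ^ 2 ≤ s * (3 * radius a x) := by
    rw [hΔeq]; exact mul_le_mul_of_nonneg_left (by linarith only [hsr, hδr]) hs0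
  -- the parameter `h = f = 512/(M²κ)`: `δh = 1024 r₊/M ≥ 968`, `hs ≤ 1/8`
  have hhpos : 0 < 512 / (M ^ 2 * κ) := by positivity
  have hδh : 968 ≤ δ * (512 / (M ^ 2 * κ)) := by
    rw [hδ, show 2 * M * rPlus M a * κ * (512 / (M ^ 2 * κ)) = 1024 * (rPlus M a / M) by
      field_simp; ring]
    have : 1 ≤ rPlus M a / M := by rwa [le_div_iff₀ hM, one_mul]
    linarith only [this]
  have hhs : 512 / (M ^ 2 * κ) * s ≤ 8⁻¹ := by
    rw [div_mul_eq_mul_div, div_le_iff₀ (by positivity)]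
    nlinarith only [hsκ, hM, hκ]
  have hfs1 : 1 + 512 / (M ^ 2 * κ) * s ≤ 2 := by linarith only [hhs]
  have hfs0 : 1 ≤ 1 + 512 / (M ^ 2 * κ) * s := by
    have := mul_nonneg hhpos.le hs0; linarith only [this]
  -- the axial coefficient
  have hαeq : horizonAngularVelocity M a * (radius a x ^ 2 + a ^ 2) / S - a / S =
      a * ((rPlus M a + s - rPlus M a) * (rPlus M a + s + rPlus M a)) / (2 * M * rPlus M a * S) := by
    rw [show horizonAngularVelocity M a = a / (2 * M * rPlus M a) from rfl,
      axialCoeff_eq hra hS.ne' hM.ne' hrp0.ne', hr]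
  have hαabs : |horizonAngularVelocity M a * (radius a x ^ 2 + a ^ 2) / S - a / S| ≤ 2 * s / S := by
    rw [hαeq]
    exact abs_axialCoeff_le hS hM hrp0 hMa' hs0 (by linarith only [hsM, hrp, hM])
  set α := horizonAngularVelocity M a * (radius a x ^ 2 + a ^ 2) / S - a / S with hα_def
  have hα2T : α ^ 2 * (radius a x ^ 2 + a ^ 2) ≤ 8 * s ^ 2 / S := by
    have h1 : α ^ 2 ≤ (2 * s / S) ^ 2 := by
      rw [← sq_abs]; exact pow_le_pow_left₀ (abs_nonneg _) hαabs 2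
    calc α ^ 2 * (radius a x ^ 2 + a ^ 2) ≤ (2 * s / S) ^ 2 * (2 * S) :=
          mul_le_mul h1 hT2 (by positivity) (by positivity)
      _ = 8 * s ^ 2 / S := by field_simp; ring
  -- smallness of the axial cross terms against `δ/(8Σ)`
  have hα1 : 380 * (512 / (M ^ 2 * κ)) * α ^ 2 * (radius a x ^ 2 + a ^ 2) ≤ δ / (8 * S) := by
    have h1 : 380 * (512 / (M ^ 2 * κ)) * α ^ 2 * (radius a x ^ 2 + a ^ 2) ≤
        380 * (512 / (M ^ 2 * κ)) * (8 * s ^ 2 / S) := by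
      rw [mul_assoc (380 * (512 / (M ^ 2 * κ)))]
      exact mul_le_mul_of_nonneg_left hα2T (by positivity)
    refine h1.trans ?_
    have h2 : 3040 * (512 / (M ^ 2 * κ) * s) * s ≤ 3040 * 8⁻¹ * s :=
      mul_le_mul_of_nonneg_right (mul_le_mul_of_nonneg_left hhs (by norm_num)) hs0
    have hM2κ : 0 ≤ M ^ 2 * κ := by positivity
    have h3 : 3040 * 8⁻¹ * s ≤ δ / 8 := by linarith only [hsκ, hδlo, hM2κ]
    calc 380 * (512 / (M ^ 2 * κ)) * (8 * s ^ 2 / S) = 3040 * (512 / (M ^ 2 * κ) * s) * s / S := by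
          ring
      _ ≤ δ / 8 / S := div_le_div_of_nonneg_right (h2.trans h3) hS.le
      _ = δ / (8 * S) := by rw [div_div]
  have hα2 : 6080 * α ^ 2 * (radius a x ^ 2 + a ^ 2) / δ ≤ δ / (8 * S) := by
    rw [div_le_div_iff₀ hδ0 (by positivity)]
    have h1 : 6080 * α ^ 2 * (radius a x ^ 2 + a ^ 2) * (8 * S) ≤ 6080 * (8 * s ^ 2 / S) * (8 * S) := by
      have := mul_le_mul_of_nonneg_left hα2T (by positivity : (0 : ℝ) ≤ 6080 * (8 * S))
      nlinarith only [this]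
    have h2 : 6080 * (8 * s ^ 2 / S) * (8 * S) = 389120 * s ^ 2 := by field_simp; ring
    rw [h2] at h1
    have hM2κ : 0 ≤ M ^ 2 * κ := by positivity
    have h3 : 624 * s ≤ δ := by linarith only [hsκ, hδlo, hM2κ]
    have h4 : 389120 * s ^ 2 ≤ δ * δ := by nlinarith only [h3, hs0]
    exact h1.trans h4
  -- the coefficients of the exact bulk
  have hcvv : δ / S ≤ ((1 + 512 / (M ^ 2 * κ) * (radius a x - rPlus M a)) * (radius a x - M) -
      2⁻¹ * (512 / (M ^ 2 * κ)) * (radius a x ^ 2 - 2 * M * radius a x + a ^ 2)) / S := by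
    refine div_le_div_of_nonneg_right ?_ hS.le
    rw [hΔeq, hs, show radius a x - M = s + δ by rw [hr, hδ_def]; ring]
    nlinarith only [hs0, sq_nonneg s, hhpos]
  have hclv0 : 0 ≤ 512 / (M ^ 2 * κ) * (radius a x ^ 2 - 2 * M * radius a x + a ^ 2) / S +
      (1 + 512 / (M ^ 2 * κ) * (radius a x - rPlus M a)) *
        (2 * radius a x * (radius a x ^ 2 + a ^ 2)) / S ^ 2 := by
    rw [hs]; positivity
  have hclv : 512 / (M ^ 2 * κ) * (radius a x ^ 2 - 2 * M * radius a x + a ^ 2) / S +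
      (1 + 512 / (M ^ 2 * κ) * (radius a x - rPlus M a)) *
        (2 * radius a x * (radius a x ^ 2 + a ^ 2)) / S ^ 2 ≤ 11 * radius a x / S := by
    rw [hs]
    have h1 : 512 / (M ^ 2 * κ) * (radius a x ^ 2 - 2 * M * radius a x + a ^ 2) / S ≤
        3 * radius a x / S := by
      refine div_le_div_of_nonneg_right ?_ hS.le
      calc 512 / (M ^ 2 * κ) * (radius a x ^ 2 - 2 * M * radius a x + a ^ 2)
          ≤ 512 / (M ^ 2 * κ) * (s * (3 * radius a x)) := mul_le_mul_of_nonneg_left hΔ3 hhpos.le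
        _ = (512 / (M ^ 2 * κ) * s) * (3 * radius a x) := by ring
        _ ≤ 8⁻¹ * (3 * radius a x) := mul_le_mul_of_nonneg_right hhs (by positivity)
        _ ≤ 3 * radius a x := by linarith only [hx]
    have h2 : (1 + 512 / (M ^ 2 * κ) * s) * (2 * radius a x * (radius a x ^ 2 + a ^ 2)) / S ^ 2 ≤
        8 * radius a x / S := by
      rw [div_le_div_iff₀ (by positivity) hS]
      have h3 : (1 + 512 / (M ^ 2 * κ) * s) * (2 * radius a x * (radius a x ^ 2 + a ^ 2)) ≤
          2 * (2 * radius a x * (2 * S)) :=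
        mul_le_mul hfs1 (mul_le_mul_of_nonneg_left hT2 (by positivity)) (by positivity) (by norm_num)
      nlinarith only [h3, hS]
    calc _ ≤ 3 * radius a x / S + 8 * radius a x / S := add_le_add h1 h2
      _ = 11 * radius a x / S := by ring
  have hcA : |(1 + 512 / (M ^ 2 * κ) * (radius a x - rPlus M a)) * (2 * radius a x / S)| ≤
      4 * radius a x / S := by
    rw [hs, abs_of_nonneg (by positivity)]
    calc (1 + 512 / (M ^ 2 * κ) * s) * (2 * radius a x / S) ≤ 2 * (2 * radius a x / S) :=
          mul_le_mul_of_nonneg_right hfs1 (by positivity)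
      _ = 4 * radius a x / S := by ring
  have hcE : |(1 + 512 / (M ^ 2 * κ) * (radius a x - rPlus M a)) * (2 * radius a x / S) * α| ≤
      4 * radius a x * |α| / S := by
    rw [abs_mul]
    calc _ ≤ 4 * radius a x / S * |α| := mul_le_mul_of_nonneg_right hcA (abs_nonneg α)
      _ = 4 * radius a x * |α| / S := by ring
  -- the quadratic-form data
  have hE : (x 1 * p 2 - x 2 * p 1) ^ 2 ≤ (radius a x ^ 2 + a ^ 2) * ∑ μ, p μ ^ 2 := by
    have h1 := axialComp_sq_le (x 1) (x 2) (p 1) (p 2)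
    have h2 : x 1 ^ 2 + x 2 ^ 2 ≤ radius a x ^ 2 + a ^ 2 := sq_add_sq_le_radius_sq_add hx
    have h3 : p 1 ^ 2 + p 2 ^ 2 ≤ ∑ μ, p μ ^ 2 := by
      simp only [Fin.sum_univ_four]; nlinarith only [sq_nonneg (p 0), sq_nonneg (p 3)]
    calc (x 1 * p 2 - x 2 * p 1) ^ 2 ≤ (x 1 ^ 2 + x 2 ^ 2) * (p 1 ^ 2 + p 2 ^ 2) := h1
      _ ≤ (radius a x ^ 2 + a ^ 2) * ∑ μ, p μ ^ 2 := mul_le_mul h2 h3 (by positivity) (by positivity)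
  have key := redShift_offHorizon_algebra (lam := hawkingComp M a x p) (v := frameIn a x p)
    (Q := frameAngSq a x (p + frameIn a x p • dRadius a x))
    (A := frameAng a x (p + frameIn a x p • dRadius a x) (dRadius a x)) (E := x 1 * p 2 - x 2 * p 1)
    (TS := (radius a x ^ 2 + a ^ 2) / S) hS hδ0 hx hδr hRS (by rwa [one_le_div hS]) hδh
    (le_trans (by norm_num) hδh) hcvv hclv0 hclv hcA hcE (frameAngSq_nonneg hx _) hW1
    (frameAng_sq_le hx _ _) (by positivity) hE hX hα1 hα2
  -- conclusion: `κ/4000 · X ≤ (δ/(8Σ))/190 · X ≤ (δ/(8Σ)) Y ≤ K^N`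
  rw [multiplierBulk_redShiftVector_offHorizon _ _ _ _ hx w]
  have hX0 : 0 ≤ ∑ μ, p μ ^ 2 := Finset.sum_nonneg fun μ _ ↦ sq_nonneg _
  have hrate : κ / 4000 ≤ δ / (8 * S) / 190 := by
    rw [div_div, div_le_div_iff₀ (by norm_num) (by positivity)]
    have hS5 : S ≤ 5 * M ^ 2 + M ^ 2 / 100 := hTS.trans hT5
    nlinarith only [hδlo, hS5, hκ, hM]
  have h1 : κ / 4000 * ∑ μ, p μ ^ 2 ≤ δ / (8 * S) / 190 * ∑ μ, p μ ^ 2 :=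
    mul_le_mul_of_nonneg_right hrate hX0
  have h2 : δ / (8 * S) / 190 * ∑ μ, p μ ^ 2 ≤ δ / (8 * S) * (hawkingComp M a x p ^ 2 +
      frameIn a x p ^ 2 + frameAngSq a x (p + frameIn a x p • dRadius a x)) := by
    rw [div_mul_eq_mul_div, div_le_iff₀ (by norm_num : (0:ℝ) < 190)]
    have := mul_le_mul_of_nonneg_left hX (by positivity : (0 : ℝ) ≤ δ / (8 * S))
    linarith only [this]
  have hp1 : fderiv ℝ w x (E4.basisVector 1) = p 1 := rfl
  have hp2 : fderiv ℝ w x (E4.basisVector 2) = p 2 := rfl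
  simp only [hp1, hp2]
  exact h1.trans (h2.trans key)

end Literature.Geometry.Lorentzian.Kerr

end
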